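import Summits.Schanuel.Schanuel.Theorems.RootDecomp1KArcCell09

/-!
# RootDecomp1KArcCell — lens 1, generation 50, node 9 «THE ARC ENGINE: separation by positive-dimensional containment; members ρ° = Π(1+4^(−k!)) and the twin σ° = Π(1+2·4^(−k!)); item 33364 decided hyp-free at zA = (1, ℓ₂, ρ°), zD = (1, ρ°, σ°) and π-twins» — continuation (RootDecomp1KArcCell10): §10 the lines of (ρ°, σ°): truncation-genericity, tightness

(lens-1 g50 HOME kernel K = HOME/decomp-schanuel-lens-1/g50/ArcCell.lean 10f1e0d5…, 3410 l · 258 decl lines, imports …RootDecomp1KCollarWall05 + …RootDecomp1KCommonRadixCell04 + …RootDecomp1KNWMeasureHolds BY NAME; P ArcCellProbe.lean af7624ff… rc 0 / C₀ ArcCellCtrl0.lean d71f613e… rc 0 / C ArcCellCtrl.lean 242a3b02… rc 1 = 42 planted; memo NODE-g50.md; CLAIM L2466, EX-ANTE PRICE + CHECKLIST K-g50 L2467, NODE L2469 / REQUEST L2470 (with the lens's ex-post self-correction: both members fall to printed dominance in substance — zA directly by Bundschuh LNM 1415 p.78 / Zhu 推论 1.3.3, zD after τ = σ°/ρ°²);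 critic VERDICT L2473: CLEARED AS PRICED EX ANTE — ONE CELL ×1 «ARC CELL (TYPED-LEVEL)» with the SUBSTANCE CAVEAT OF RECORD (both members inside the archimedean dominance class in substance; E2 convenient, not necessary), RULE K-R39 FIXED, PORT GO. Port by census-1 gen 21 as `RootDecomp1KArcCell01–13` along K's §1–§12 with §4, §7 and §12 cut at decl boundaries by the 400-line file cap: 01 = §1 (E1) `aeval_one_div_two_pow_ne_zero` (dyadic root lemma) + §2 (E2) `toPolyPoly`, `arc_count` (a relation contains ≤ deg q of an injective family of rational arcs — roots over the domain ℚ[X]); 02 = §3 (A) the member: `dfac`, `arcNum`, `arcProdQ` (ρ°_N), `sQ`, `rhoArc` (ρ° = Π(1 + 4^(−k!))) and its tails; 03 = §4a (E3) `TruncGenericSeq` («[class] definition» tag) + **`algebraicIndependent_of_truncGenericSeq`** (the g36/g37 extraction re-plumbed to arbitrary dyadic-type schedules); 04 = §4b `psQ`, the link `truncGeneric_iff_truncGenericSeq` and the tree (X′) re-derived — K's `theorem algebraicIndependent_liouville_of_truncGeneric'` DEMOTED to a documented `example` (its statement is byte-identical to the tree's `RootDecomp1KCommonRadixCell.algebraicIndependent_liouville_of_truncGeneric`,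 CommonRadixCell03 l.98 — dedup twin flagged by the writer L2472 (α), demotion pre-sanctioned by the critic L2473; nothing in K uses the primed name); 05 = §5 the arcs of ρ°: `arcPoly`, `arcF`, `arcBasis`, `arcScal`, `clearArc`, `truncGenericSeq_arc`, tightness `qArc` / `qArc_tight`; 06 = §6 the arc cell `algebraicIndependent_arc_of_mvPolyMeasure`, `algebraicIndependent_rhoArc_ell2`, walls `sb_arcWall3(_pi)`, item-shape instances + §7 head `zA` / `zApi`, `linearIndependent_zA(pi)`, `linLiouville_zA(pi)`; 07 = §7a the ONE 2-adic cut `cutA` + **`form_lower_bound_A`** (exponent 9), `not_hyperLinLiouville_zA(pi)` (m₀ = 10), `sb_zA(pi)`, `finiteOrderLiouvilleSchanuel_at_zA(pi)`, `item33364_at_zA(pi)`, `item31077_at_zA`; 08 = §8 `rhoArc_position` (11 conjuncts by tree name) and its lemmas, `liouville_rhoArc`; 09 = §9 (A′) the twin σ° = Π(1 + 2·4^(−k!)): `arcNum2`, `arcOdd2`, `arcProdQ2`, `sigmaArc`, `liouville_sigmaArc`; 10 = §10 the lines of (ρ°, σ°): `linPoly`, `linF`, `linBasis`, `linScal`, `clearLin`,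 `truncGenericSeq_lin`, `qLin` / `qLin_tight`; 11 = §11 the twin cell `algebraicIndependent_twin_of_mvPolyMeasure`, walls `sb_twinWall3(_pi)`, item-shape instances + §12 head `zD` / `zDpi`, binders; 12 = §12a part 1 the archimedean two-level cut `cutD`, `cutD_succ_ne_zero`, `cutD_height_bound`; 13 = §12a part 2 **`form_lower_bound_D`** (exponent 7), `not_hyperLinLiouville_zD(pi)` (m₀ = 8), `sb_zD(pi)`, `item33364_at_zD(pi)`, `zD_shape`. PORT EDITS (census convention): `set_option linter.dupNamespace false` dropped; 77 one-line helper docstrings added (statements quoted); per-part private helper copies; sections `Extraction` / `Members` / `TwinMembers` closed and re-opened across the cuts with their `variable` / `open` lines; statements and proofs otherwise verbatim (no renames; K's own private markers kept). `--supports stmt-Schanuel-33364`; no census credit carried; rung 0 — nothing here proves Schanuel; no ∀-item moves; 33364, 33363, 31077 stay OPEN.)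
-/

noncomputable section

open Polynomial LiouvilleNumber
open scoped Nat

namespace Summit.Schanuel.Schanuel.Theorems.RootDecomp1KArcCell

open Summit.Schanuel.Schanuel.Theorems.RootDecomp1KCollarCell
open Summit.Schanuel.Schanuel.Theorems.RootDecomp1KGapCell
open Summit.Schanuel.Schanuel.Theorems.RootDecomp1KTwoBaseCell
open Summit.Schanuel.Schanuel.Theorems.RootDecomp1KRelLiouvilleCell
open Summit.Schanuel.Schanuel.Theorems.RootDecomp1KNWMeasureHolds (polyMeasure_exp_one_holds)
open Summit.Schanuel.Schanuel.Theorems.RootDecomp1KHyper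
open Summit.Schanuel.Schanuel.Theorems.RootDecomp1KHyper.HyperCell
open Summit.Schanuel.Schanuel.Theorems.RootDecomp1KCommonRadixCell (TruncGeneric algebraicIndependent_liouville_of_truncGeneric)

/-- For natural coefficients every coefficient is at most the value at `1`. -/
private theorem coeff_le_eval_one (B : Polynomial ℕ) (j : ℕ) : B.coeff j ≤ B.eval 1 := by
  rw [Polynomial.eval_eq_sum, Polynomial.sum_def]
  simp only [one_pow, mul_one]
  by_cases hj : B.coeff j = 0
  · rw [hj]; exact Nat.zero_le _
  · exact Finset.single_le_sum (f := fun i => B.coeff i) (fun _ _ => Nat.zero_le _)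
      (Polynomial.mem_support_iff.mpr hj)

/-! ## §10  (A′) THE LINES OF `(ρ°, σ°)` — truncation-genericity of `((ρ°_N, σ°_N))_N` BY THE ARC ENGINE (E2 + E1)

The level points `Q_N = (ρ°_N, σ°_N)` satisfy `Q_N = (ρ°_{N-1}(1 + u), σ°_{N-1}(1 + 2u))`, `u = 4^{-N!}`: `Q_N` lies on the LINE
`λ_{N-1} : T ↦ (ρ°_{N-1}(1 + T), σ°_{N-1}(1 + 2T))` at the parameter `T = u`.  As graphs `X₀ = f_M(X₁)` the lines
`f_M = (ρ°_M/(2σ°_M))·X₁ + ρ°_M/2` are pairwise DISTINCT (constant term `ρ°_M/2` strictly increasing), so (E2) `arc_count` applies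
verbatim; the cleared restriction has coefficients `≤ L·16^d·4^{d·D_M} < 4^{(M+1)!}` beyond the threshold, and (E1) forbids the root
`u_{M+1}`.  ONE level CAN be contained (`qLin_tight`). -/
section Lines

/-- `q` restricted to the line of stage `M`: `q(ρ°_M (1 + T), σ°_M (1 + 2T)) ∈ ℚ[T]`. -/
def linPoly (q : MvPolynomial (Fin 2) ℤ) (M : ℕ) : ℚ[X] :=
  MvPolynomial.aeval
    (![Polynomial.C (arcProdQ M) * (1 + Polynomial.X),
       Polynomial.C (arcProdQ2 M) * (1 + Polynomial.C 2 * Polynomial.X)] : Fin 2 → ℚ[X]) q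

/-- The line of stage `M` as a graph over the second coordinate: `X₀ = f_M(X₁)`, `f_M = (ρ°_M/(2σ°_M))·X₁ + ρ°_M/2`. -/
def linF (M : ℕ) : ℚ[X] :=
  Polynomial.C (arcProdQ M / (2 * arcProdQ2 M)) * Polynomial.X + Polynomial.C (arcProdQ M / 2)

/-- `(m : ℕ) : (1 : ℚ) / 2 ^ (2 * m) = 1 / 4 ^ m`. -/
theorem one_div_two_pow_two_mul (m : ℕ) : (1 : ℚ) / 2 ^ (2 * m) = 1 / 4 ^ m := by
  rw [pow_mul]; norm_num

/-- THE LEVEL POINT LIES ON THE PRECEDING LINE: `(q|_{λ_M})(u_{M+1}) = q(ρ°_{M+1}, σ°_{M+1})`. -/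
theorem linPoly_eval (q : MvPolynomial (Fin 2) ℤ) (M : ℕ) :
    (linPoly q M).eval (1 / 4 ^ (M + 1)!) = MvPolynomial.aeval ![arcProdQ (M + 1), arcProdQ2 (M + 1)] q := by
  rw [linPoly, ← Polynomial.coe_evalRingHom, map_aeval_int]
  have hw : (fun i => (evalRingHom ((1 : ℚ) / 4 ^ (M + 1)!))
      ((![Polynomial.C (arcProdQ M) * (1 + Polynomial.X),
          Polynomial.C (arcProdQ2 M) * (1 + Polynomial.C 2 * Polynomial.X)] : Fin 2 → ℚ[X]) i)) =
      ![arcProdQ (M + 1), arcProdQ2 (M + 1)] := by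
    funext i
    fin_cases i
    · show Polynomial.eval ((1 : ℚ) / 4 ^ (M + 1)!) (Polynomial.C (arcProdQ M) * (1 + Polynomial.X)) =
        arcProdQ (M + 1)
      rw [eval_mul, eval_C, eval_add, eval_one, eval_X, arcProdQ_succ]
    · show Polynomial.eval ((1 : ℚ) / 4 ^ (M + 1)!)
          (Polynomial.C (arcProdQ2 M) * (1 + Polynomial.C 2 * Polynomial.X)) = arcProdQ2 (M + 1)
      rw [eval_mul, eval_C, eval_add, eval_one, eval_mul, eval_C, eval_X, arcProdQ2_succ]
      ring
  rw [hw]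

/-- CONTAINMENT TRANSFERS FROM THE GRAPH FORM: `q|_{λ_M} = q(f_M(X), X) ∘ (σ°_M (1 + 2X))`. -/
theorem linPoly_eq_comp (q : MvPolynomial (Fin 2) ℤ) (M : ℕ) :
    linPoly q M = (MvPolynomial.aeval ![linF M, Polynomial.X] q).comp
      (Polynomial.C (arcProdQ2 M) * (1 + Polynomial.C 2 * Polynomial.X)) := by
  rw [← Polynomial.coe_compRingHom_apply, map_aeval_int, linPoly]
  have hσ : arcProdQ2 M ≠ 0 := (arcProdQ2_pos M).ne'
  have hw : (fun i => (Polynomial.compRingHom (Polynomial.C (arcProdQ2 M) * (1 + Polynomial.C 2 * Polynomial.X)))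
      ((![linF M, Polynomial.X] : Fin 2 → ℚ[X]) i)) =
      ![Polynomial.C (arcProdQ M) * (1 + Polynomial.X),
        Polynomial.C (arcProdQ2 M) * (1 + Polynomial.C 2 * Polynomial.X)] := by
    funext i
    fin_cases i
    · show (linF M).comp (Polynomial.C (arcProdQ2 M) * (1 + Polynomial.C 2 * Polynomial.X)) =
        Polynomial.C (arcProdQ M) * (1 + Polynomial.X)
      refine Polynomial.funext fun t => ?_
      simp only [linF, eval_comp, eval_add, eval_mul, eval_C, eval_X, eval_one]
      field_simp
      ring
    · show (Polynomial.X : ℚ[X]).comp (Polynomial.C (arcProdQ2 M) * (1 + Polynomial.C 2 * Polynomial.X)) =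
        Polynomial.C (arcProdQ2 M) * (1 + Polynomial.C 2 * Polynomial.X)
      rw [X_comp]
  rw [hw]

/-- A line of the family NOT contained in `{q = 0}` (graph form) gives a non-zero restriction `q|_{λ_M} ≠ 0`. -/
theorem linPoly_ne_zero_of_aeval_linF {q : MvPolynomial (Fin 2) ℤ} {M : ℕ}
    (h : MvPolynomial.aeval ![linF M, Polynomial.X] q ≠ 0) : linPoly q M ≠ 0 := by
  rw [linPoly_eq_comp]
  intro h0
  rcases (Polynomial.comp_eq_zero_iff.mp h0) with h1 | ⟨-, h2⟩
  · exact h h1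
  · have e0 := congrArg (Polynomial.eval 0) h2
    have e1 := congrArg (Polynomial.eval 1) h2
    simp only [eval_mul, eval_C, eval_add, eval_one, eval_X, mul_zero, add_zero, mul_one] at e0 e1
    have hσ := arcProdQ2_pos M
    linarith

/-- `(M : ℕ) : (linF M).eval 0 = arcProdQ M / 2`. -/
theorem linF_eval_zero (M : ℕ) : (linF M).eval 0 = arcProdQ M / 2 := by
  simp [linF]

/-- THE LINES ARE PAIRWISE DISTINCT (their constant terms `ρ°_M/2` increase strictly). -/
theorem linF_injective : Function.Injective linF := by
  intro M M' h
  have h1 := congrArg (fun p : ℚ[X] => p.eval 0) h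
  simp only [linF_eval_zero] at h1
  exact arcProdQ_strictMono.injective (by linarith)

/-- The line basis polynomials `(1 + T)^{e₀} (1 + 2T)^{e₁}` with NATURAL coefficients. -/
def linBasis (e₀ e₁ : ℕ) : Polynomial ℕ :=
  (1 + Polynomial.X) ^ e₀ * (1 + Polynomial.C 2 * Polynomial.X) ^ e₁

/-- `(e₀ e₁ : ℕ) : (linBasis e₀ e₁).eval 1 = 2 ^ e₀ * 3 ^ e₁`. -/
theorem linBasis_eval_one (e₀ e₁ : ℕ) : (linBasis e₀ e₁).eval 1 = 2 ^ e₀ * 3 ^ e₁ := by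
  rw [linBasis, eval_mul, eval_pow, eval_pow, eval_add, eval_one, eval_X, eval_add, eval_one, eval_mul, eval_C,
    eval_X]
  norm_num

/-- The line scalars `r^{e₀} p^{e₁} a^{d − (e₀ + e₁)}`. -/
def linScal (d r p a : ℕ) (e : Fin 2 →₀ ℕ) : ℕ := r ^ e 0 * p ^ e 1 * a ^ (d - (e 0 + e 1))

/-- THE CLEARED RESTRICTION `a^d · q(r/a·(1 + T), p/a·(1 + 2T)) ∈ ℤ[T]`, written on the line basis (`map_clearLin`). -/
def clearLin (q : MvPolynomial (Fin 2) ℤ) (d r p a : ℕ) : ℤ[X] :=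
  ∑ e ∈ q.support, Polynomial.C (q.coeff e * (linScal d r p a e : ℤ)) *
    Polynomial.map (Nat.castRingHom ℤ) (linBasis (e 0) (e 1))

/-- The basis polynomial `linBasis e₀ e₁` mapped to `ℚ[X]` is `(1 + X)^{e₀} · (1 + 2X)^{e₁}`. -/
theorem map_linBasis (e₀ e₁ : ℕ) :
    (Polynomial.map (Nat.castRingHom ℤ) (linBasis e₀ e₁)).map (Int.castRingHom ℚ) =
      (1 + Polynomial.X) ^ e₀ * (1 + Polynomial.C (2 : ℚ) * Polynomial.X) ^ e₁ := by
  rw [Polynomial.map_map, Subsingleton.elim ((Int.castRingHom ℚ).comp (Nat.castRingHom ℤ)) (Nat.castRingHom ℚ),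
    linBasis, Polynomial.map_mul, Polynomial.map_pow, Polynomial.map_pow, Polynomial.map_add, Polynomial.map_one,
    Polynomial.map_X, Polynomial.map_add, Polynomial.map_one, Polynomial.map_mul, Polynomial.map_C,
    Polynomial.map_X, map_ofNat]

/-- `clearLin` IS the cleared restriction: over `ℚ`, `clearLin = a^d · q(ρ (1 + T), σ (1 + 2T))` when `r = ρ a`, `p = σ a`
and `d` bounds the total degree. -/
theorem map_clearLin (q : MvPolynomial (Fin 2) ℤ) {d r p a : ℕ} {ρ σ : ℚ} (hr : (r : ℚ) = ρ * a)
    (hp : (p : ℚ) = σ * a) (hdeg : ∀ e ∈ q.support, e 0 + e 1 ≤ d) :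
    (clearLin q d r p a).map (Int.castRingHom ℚ) =
      Polynomial.C ((a : ℚ) ^ d) *
        MvPolynomial.aeval
          (![Polynomial.C ρ * (1 + Polynomial.X),
             Polynomial.C σ * (1 + Polynomial.C 2 * Polynomial.X)] : Fin 2 → ℚ[X]) q := by
  classical
  rw [clearLin, Polynomial.map_sum, MvPolynomial.aeval_def, MvPolynomial.eval₂_eq', Finset.mul_sum]
  refine Finset.sum_congr rfl fun e he => ?_
  have h01 := hdeg e he
  obtain ⟨t, ht⟩ := Nat.exists_eq_add_of_le h01
  have hs : d - (e 0 + e 1) = t := by omega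
  rw [Polynomial.map_mul, Polynomial.map_C, map_linBasis, Fin.prod_univ_two, linScal, hs]
  simp only [Matrix.cons_val_zero, Matrix.cons_val_one, eq_intCast, ← Polynomial.C_eq_intCast]
  push_cast
  have ha : (a : ℚ) ^ d = (a : ℚ) ^ e 0 * (a : ℚ) ^ e 1 * (a : ℚ) ^ t := by
    rw [← pow_add, ← pow_add, ← ht]
  rw [ha, hr, hp]
  simp only [Polynomial.C_mul, Polynomial.C_pow, mul_pow]
  ring

/-- COEFFICIENT BOUND for the cleared restriction: `|coeff_j| ≤ L(q) · 16^d a^d` when `r ≤ 3a`, `p ≤ 5a` and `d` bounds the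
total degree. -/
theorem abs_coeff_clearLin_le (q : MvPolynomial (Fin 2) ℤ) {d r p a : ℕ} (hr : r ≤ 3 * a) (hp : p ≤ 5 * a)
    (hdeg : ∀ e ∈ q.support, e 0 + e 1 ≤ d) (j : ℕ) :
    |(clearLin q d r p a).coeff j| ≤ mvlen q * ((16 : ℤ) ^ d * (a : ℤ) ^ d) := by
  classical
  rw [clearLin, Polynomial.finsetSum_coeff]
  refine (Finset.abs_sum_le_sum_abs _ _).trans ?_
  rw [mvlen, Finset.sum_mul]
  refine Finset.sum_le_sum fun e he => ?_
  rw [Polynomial.coeff_C_mul, Polynomial.coeff_map, abs_mul, abs_mul]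
  have hed := hdeg e he
  have hB : (linBasis (e 0) (e 1)).coeff j ≤ 2 ^ e 0 * 3 ^ e 1 := by
    rw [← linBasis_eval_one]; exact coeff_le_eval_one _ j
  have hnat : linScal d r p a e * (linBasis (e 0) (e 1)).coeff j ≤ 16 ^ d * a ^ d := by
    obtain ⟨t, ht⟩ := Nat.exists_eq_add_of_le hed
    have hs : d - (e 0 + e 1) = t := by omega
    have h1 : r ^ e 0 ≤ (3 * a) ^ e 0 := Nat.pow_le_pow_left hr _
    have h2 : p ^ e 1 ≤ (5 * a) ^ e 1 := Nat.pow_le_pow_left hp _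
    have h6 : (6 : ℕ) ^ e 0 ≤ 16 ^ e 0 := Nat.pow_le_pow_left (by norm_num) _
    have h15 : (15 : ℕ) ^ e 1 ≤ 16 ^ e 1 := Nat.pow_le_pow_left (by norm_num) _
    have h16 : (16 : ℕ) ^ (e 0 + e 1) ≤ 16 ^ d := Nat.pow_le_pow_right (by norm_num) hed
    calc linScal d r p a e * (linBasis (e 0) (e 1)).coeff j
        ≤ (r ^ e 0 * p ^ e 1 * a ^ (d - (e 0 + e 1))) * (2 ^ e 0 * 3 ^ e 1) := Nat.mul_le_mul_left _ hB
      _ ≤ ((3 * a) ^ e 0 * (5 * a) ^ e 1 * a ^ t) * (2 ^ e 0 * 3 ^ e 1) := by rw [hs]; gcongr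
      _ = (3 ^ e 0 * 2 ^ e 0) * (5 ^ e 1 * 3 ^ e 1) * (a ^ e 0 * a ^ e 1 * a ^ t) := by
          rw [mul_pow, mul_pow]; ring
      _ = 6 ^ e 0 * 15 ^ e 1 * a ^ d := by
          rw [← mul_pow, ← mul_pow, ← pow_add, ← pow_add, ← ht]
          norm_num
      _ ≤ 16 ^ e 0 * 16 ^ e 1 * a ^ d := by gcongr
      _ = 16 ^ (e 0 + e 1) * a ^ d := by rw [← pow_add]
      _ ≤ 16 ^ d * a ^ d := by gcongr
  have hcast : ((linScal d r p a e : ℕ) : ℤ) * ((linBasis (e 0) (e 1)).coeff j : ℤ) ≤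
      (16 : ℤ) ^ d * (a : ℤ) ^ d := by exact_mod_cast hnat
  have hnn1 : (0 : ℤ) ≤ (linScal d r p a e : ℕ) := by positivity
  have hnn2 : (0 : ℤ) ≤ ((linBasis (e 0) (e 1)).coeff j : ℕ) := by positivity
  simp only [Nat.coe_castRingHom]
  rw [abs_of_nonneg hnn1, abs_of_nonneg hnn2, mul_assoc]
  exact mul_le_mul_of_nonneg_left hcast (abs_nonneg _)

/-- THE THRESHOLD: beyond `M ≥ 8d + L` the coefficient bound `L · 2^{4d + 2d·D_M}` is BELOW the gap `2^{2(M+1)!} = 4^{(M+1)!}`. -/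
theorem lin_threshold {d L M : ℕ} (hM : 8 * d + L ≤ M) :
    L * 2 ^ (4 * d + 2 * d * dfac M) < 2 ^ (2 * (M + 1)!) := by
  have hD := dfac_le M
  have hf : 1 ≤ M ! := Nat.factorial_pos M
  have hexp : 4 * d + 2 * d * dfac M + (L + 1) ≤ 2 * (M + 1)! := by
    rw [Nat.factorial_succ]
    have h1 : 2 * d * dfac M ≤ 2 * d * (2 * M !) := Nat.mul_le_mul_left _ hD
    have h2 : 4 * d ≤ 4 * d * M ! := Nat.le_mul_of_pos_right _ hf
    have h3 : L + 1 ≤ (L + 1) * M ! := Nat.le_mul_of_pos_right _ hf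
    have h4 : (8 * d + L + 1) * M ! ≤ (M + 1) * M ! := Nat.mul_le_mul_right _ (by omega)
    have e4 : (8 * d + L + 1) * M ! = 4 * d * M ! + 2 * d * (2 * M !) + (L + 1) * M ! := by ring
    have h5 : (M + 1) * M ! ≤ 2 * ((M + 1) * M !) := by omega
    omega
  have hL : L < 2 ^ (L + 1) :=
    Nat.lt_two_pow_self.trans (Nat.pow_lt_pow_right (by norm_num) (by omega))
  calc L * 2 ^ (4 * d + 2 * d * dfac M)
      < 2 ^ (L + 1) * 2 ^ (4 * d + 2 * d * dfac M) :=
        Nat.mul_lt_mul_of_pos_right hL (pow_pos (by norm_num) _)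
    _ = 2 ^ (4 * d + 2 * d * dfac M + (L + 1)) := by rw [← pow_add, add_comm]
    _ ≤ 2 ^ (2 * (M + 1)!) := Nat.pow_le_pow_right (by norm_num) hexp

/-- **THE ARC ENGINE AT THE TWIN PAIR: `((ρ°_N, σ°_N))_N` IS TRUNCATION-GENERIC** — (E2) `arc_count` over the injective family
of LINES `linF` finds a stage `M ≥ max N₀ (8d + L)` with `q|_{λ_M} ≠ 0`; its cleared form `clearLin ∈ ℤ[T]` has all coefficients
`< 2^{2(M+1)!}` (`abs_coeff_clearLin_le`, `lin_threshold`), so (E1) forbids the root `T = u_{M+1} = 4^{-(M+1)!} = 2^{-2(M+1)!}`,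
i.e. `q(ρ°_{M+1}, σ°_{M+1}) ≠ 0` (`linPoly_eval`). -/
theorem truncGenericSeq_lin : TruncGenericSeq ![arcProdQ, arcProdQ2] := by
  classical
  intro q hq N₀
  set d : ℕ := q.totalDegree with hd
  have hLnn : 0 ≤ mvlen q := mvlen_nonneg q
  set L : ℕ := (mvlen q).toNat with hL
  have hLz : (L : ℤ) = mvlen q := by rw [hL]; exact Int.toNat_of_nonneg hLnn
  obtain ⟨M, hM₁, -, hgood⟩ := arc_count hq linF_injective (max N₀ (8 * d + L))
  have hMN : N₀ ≤ M := le_trans (le_max_left _ _) hM₁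
  have hMd : 8 * d + L ≤ M := le_trans (le_max_right _ _) hM₁
  have hP : linPoly q M ≠ 0 := linPoly_ne_zero_of_aeval_linF hgood
  refine ⟨M + 1, by omega, ?_⟩
  have hdeg : ∀ e ∈ q.support, e 0 + e 1 ≤ d := fun e he => by
    have h1 := MvPolynomial.le_totalDegree he
    rwa [Finsupp.sum_fintype _ _ (fun _ => rfl), Fin.sum_univ_two] at h1
  -- the data of the line `λ_M`
  set a : ℕ := 4 ^ dfac M with ha
  set r : ℕ := arcNum M with hr
  set p : ℕ := arcNum2 M with hp
  have hapos : (0 : ℚ) < a := by rw [ha]; positivity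
  have hrq : (r : ℚ) = arcProdQ M * a := by
    rw [hr, ha, ← arcProdQ_mul_den M]; push_cast; rfl
  have hpq : (p : ℚ) = arcProdQ2 M * a := by
    rw [hp, ha, ← arcProdQ2_mul_den M]; push_cast; rfl
  have hr3 : r ≤ 3 * a := by
    have h3 := arcProdQ_lt_three' M
    have h : (r : ℚ) ≤ 3 * a := by rw [hrq]; nlinarith
    exact_mod_cast h
  have hp5 : p ≤ 5 * a := by
    have h5 := arcProdQ2_lt_five' M
    have h : (p : ℚ) ≤ 5 * a := by rw [hpq]; nlinarith
    exact_mod_cast h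
  -- the cleared restriction and its image over `ℚ`
  set Acl : ℤ[X] := clearLin q d r p a with hAcl
  have hmap : Acl.map (Int.castRingHom ℚ) = Polynomial.C ((a : ℚ) ^ d) * linPoly q M :=
    map_clearLin q hrq hpq hdeg
  have ha0 : Polynomial.C ((a : ℚ) ^ d) ≠ 0 := by
    rw [Ne, Polynomial.C_eq_zero]; positivity
  have hA0 : Acl ≠ 0 := by
    intro h0
    apply hP
    have h1 : Polynomial.C ((a : ℚ) ^ d) * linPoly q M = 0 := by rw [← hmap, h0, Polynomial.map_zero]
    rcases mul_eq_zero.mp h1 with h | h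
    · exact absurd h ha0
    · exact h
  -- the coefficient bound is BELOW the gap
  have hcoef : ∀ j, |Acl.coeff j| < 2 ^ (2 * (M + 1)!) := fun j => by
    refine lt_of_le_of_lt (abs_coeff_clearLin_le q hr3 hp5 hdeg j) ?_
    have e16 : (16 : ℤ) ^ d * (a : ℤ) ^ d = 2 ^ (4 * d + 2 * d * dfac M) := by
      rw [ha]; push_cast
      rw [show (16 : ℤ) = 2 ^ 4 by norm_num, show (4 : ℤ) = 2 ^ 2 by norm_num]
      rw [← pow_mul, ← pow_mul, ← pow_mul, ← pow_add]
      congr 1; ring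
    rw [e16, ← hLz]
    exact_mod_cast lin_threshold hMd
  -- (E1): the point `u_{M+1} = 2^{-2(M+1)!}` is not a root of the cleared restriction
  have hne := aeval_one_div_two_pow_ne_zero hA0 hcoef
  intro h0
  apply hne
  have hx : (fun i => (![arcProdQ, arcProdQ2] : Fin 2 → ℕ → ℚ) i (M + 1)) =
      ![arcProdQ (M + 1), arcProdQ2 (M + 1)] := by
    funext i; fin_cases i <;> rfl
  rw [hx] at h0
  rw [Polynomial.aeval_def, Polynomial.eval₂_eq_eval_map, algebraMap_int_eq, hmap, Polynomial.eval_mul,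
    Polynomial.eval_C, one_div_two_pow_two_mul, linPoly_eval, h0, mul_zero]

/-- **TIGHTNESS — ONE LEVEL CAN BE CONTAINED.**  The cleared equation of the line `λ_0` through `Q_0 = (5/4, 3/2)` with
direction `(5/4, 3)`: `qLin = 24·X₀ − 10·X₁ − 15 ∈ ℤ[X₀, X₁]`. -/
def qLin : MvPolynomial (Fin 2) ℤ :=
  24 * MvPolynomial.X 0 - 10 * MvPolynomial.X 1 - 15

/-- `qLin ≠ 0` (its value at `(1, 1)` is `-1`) and the whole line `λ_0` lies in `{qLin = 0}`. -/
theorem qLin_tight : qLin ≠ 0 ∧ linPoly qLin 0 = 0 := by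
  constructor
  · intro h
    have h1 := congrArg (MvPolynomial.eval (fun _ : Fin 2 => (1 : ℤ))) h
    simp [qLin] at h1
  · refine Polynomial.funext fun t => ?_
    rw [linPoly, ← Polynomial.coe_evalRingHom, map_aeval_int]
    simp only [qLin, map_sub, map_mul, MvPolynomial.aeval_X]
    simp [arcProdQ_zero, arcProdQ2_zero]
    ring

/-- The level points `Q_0 = (5/4, 3/2)` and `Q_1 = (25/16, 9/4)` both lie on `{qLin = 0}`. -/
theorem qLin_level_zero : MvPolynomial.aeval ![arcProdQ 0, arcProdQ2 0] qLin = 0 := by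
  simp [qLin, arcProdQ_zero, arcProdQ2_zero]; norm_num

/-- Tightness: the explicit relation `qLin` vanishes at the level-one point `(ρ°_1, σ°_1)`. -/
theorem qLin_level_one : MvPolynomial.aeval ![arcProdQ 1, arcProdQ2 1] qLin = 0 := by
  rw [← linPoly_eval, qLin_tight.2, Polynomial.eval_zero]

end Lines

end Summit.Schanuel.Schanuel.Theorems.RootDecomp1KArcCell

end
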